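import Literature.AnabelianGeometry.SemiGraphs.ProfiniteHomToAnab
import Literature.AnabelianGeometry.Anabelioids.BCatBranchConjugacy
import Literature.AnabelianGeometry.Anabelioids.ExactFunctorProofs
import HarnessLib

/-!
# [SemiAnbd] §2/§3: the two presentations — locally open morphisms (Def. 2.2 (ii) p. 24)

Mochizuki, *Semi-graphs of anabelioids*, Publ. RIMS **42** (2006), Def. 2.2 (ii) p. 24
[cite: MochizukiSemiAnbd2006, Def 2.2(ii) p.24]: a morphism is *locally open* if each induced
morphism of constituent anabelioids induces a homomorphism with open image on `π̂₁`.  The §3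
rendering (`ProfiniteSemiGraph.Hom.IsLocallyOpen`: `range F_v`, `range F_e` open) and the §2
rendering (`SemiGraphOfAnabelioids.Hom.IsLocallyOpen`: `range π₁(φ_v^*)`, `range π₁(φ_e^*)` open
for EVERY basepoint) agree on `F.toAnab` (`toAnab_isLocallyOpen_iff`): at any basepoint the image
of `π₁(res F_v)` is carried by a TOPOLOGICAL identification `Aut(res F_v ⋙ β) ≃ₜ* Π_{f v}` to a
conjugate of `range F_v` (`exists_continuousMulEquiv_forall_range_conj`).  Proof-only file.
-/

noncomputable section

namespace Literature.AnabelianGeometry.SemiGraphs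

open CategoryTheory CategoryTheory.Limits CategoryTheory.PreGaloisCategory
open Literature.AnabelianGeometry.Anabelioids
open Literature.AlgebraicGeometry.Frobenioids (BCat)
open scoped FintypeCatDiscrete Pointwise

universe u

/-- Openness of the image of `π₁(res ψ)` at a basepoint `F_b` of `B(H)`, for `ψ : H → K` continuous
between profinite groups, is openness of `range ψ`. [cite: MochizukiSemiAnbd2006, Def 2.2(ii) p.24] -/
theorem isOpen_range_pi1Map_res_iff {K H : Type u} [Group K] [TopologicalSpace K]
    [IsTopologicalGroup K] [CompactSpace K] [TotallyDisconnectedSpace K] [Group H]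
    [TopologicalSpace H] [IsTopologicalGroup H] [CompactSpace H] [TotallyDisconnectedSpace H]
    (ψ : H →ₜ* K) (Fb : BCat H ⥤ FintypeCat.{u}) (hFb : letI := galoisCategory_bCat H; FiberFunctor Fb) :
    IsOpen (Set.range (pi1Map (ContAction.res FintypeCat.{u} ψ) Fb)) ↔
      IsOpen (Set.range ψ) := by
  letI := galoisCategory_bCat K
  letI := galoisCategory_bCat H
  haveI := hFb
  haveI : PreservesFiniteLimits (ContAction.res FintypeCat.{u} ψ) := (bCatMap ψ).property.1
  haveI : PreservesFiniteColimits (ContAction.res FintypeCat.{u} ψ) := (bCatMap ψ).property.2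
  have hF : FiberFunctor (ContAction.res FintypeCat.{u} ψ ⋙ Fb) := fiberFunctor_comp_of_exact _ _
  obtain ⟨θ, hθ⟩ := exists_continuousMulEquiv_forall_range_conj K (ContAction.res FintypeCat.{u} ψ ⋙ Fb) hF
  obtain ⟨x, hx⟩ := hθ H ψ Fb hFb (Iso.refl _)
  -- the transported subgroup is just the range (the transport along `Iso.refl` is the identity)
  have hrange : ((Aut.autMulEquivOfIso (Iso.refl (ContAction.res FintypeCat.{u} ψ ⋙ Fb))).toMonoidHom.comp
      (pi1Map (ContAction.res FintypeCat.{u} ψ) Fb)).range =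
      (pi1Map (ContAction.res FintypeCat.{u} ψ) Fb).range := by
    ext σ
    simp only [MonoidHom.mem_range, MonoidHom.comp_apply, MulEquiv.coe_toMonoidHom]
    constructor
    · rintro ⟨τ, rfl⟩
      refine ⟨τ, Iso.ext ?_⟩
      change _ = (Iso.refl _).inv ≫ _ ≫ (Iso.refl _).hom
      simp
    · rintro ⟨τ, rfl⟩
      refine ⟨τ, Iso.ext ?_⟩
      change (Iso.refl _).inv ≫ _ ≫ (Iso.refl _).hom = _
      simp
  rw [hrange] at hx
  -- openness transfers along the homeomorphism `θ` and conjugation by `x`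
  have e1 : IsOpen (Set.range (pi1Map (ContAction.res FintypeCat.{u} ψ) Fb)) ↔
      IsOpen (θ.toHomeomorph '' Set.range (pi1Map (ContAction.res FintypeCat.{u} ψ) Fb)) :=
    θ.toHomeomorph.isOpen_image.symm
  have e2 : θ.toHomeomorph '' Set.range (pi1Map (ContAction.res FintypeCat.{u} ψ) Fb) =
      ((ConjAct.toConjAct x • ψ.toMonoidHom.range : Subgroup K) : Set K) := by
    rw [← hx, Subgroup.coe_map, MonoidHom.coe_range]
    rfl
  let c : K ≃ₜ K := (Homeomorph.mulLeft x).trans (Homeomorph.mulRight x⁻¹)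
  have e3 : ((ConjAct.toConjAct x • ψ.toMonoidHom.range : Subgroup K) : Set K) =
      c '' Set.range ψ := by
    ext y
    simp only [SetLike.mem_coe, Set.mem_image, Set.mem_range]
    rw [Subgroup.mem_smul_pointwise_iff_exists]
    constructor
    · rintro ⟨s, ⟨h, rfl⟩, rfl⟩
      refine ⟨ψ h, ⟨h, rfl⟩, ?_⟩
      rw [ConjAct.smul_def, ConjAct.ofConjAct_toConjAct]
      rfl
    · rintro ⟨_, ⟨h, rfl⟩, rfl⟩
      refine ⟨ψ h, ⟨h, rfl⟩, ?_⟩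
      rw [ConjAct.smul_def, ConjAct.ofConjAct_toConjAct]
      rfl
  rw [e1, e2, e3]
  exact c.isOpen_image

namespace ProfiniteSemiGraph

variable {𝒢 ℋ : ProfiniteSemiGraph.{u}}

/-- **Locally open agrees in the two presentations**: `F.toAnab` is locally open in the §2 sense
(open image on `π₁` at every basepoint) iff `F` is locally open in the §3 sense (open images of the
`F_v`, `F_e`). [cite: MochizukiSemiAnbd2006, Def 2.2(ii) p.24] -/
theorem Hom.toAnab_isLocallyOpen_iff (F : Hom 𝒢 ℋ) :
    F.toAnab.IsLocallyOpen ↔ F.IsLocallyOpen := by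
  constructor
  · rintro ⟨hV, hE⟩
    refine ⟨fun v => ?_, fun e => ?_⟩
    · have h := @hV v (ObjectProperty.ι (Action.IsContinuous (V := FintypeCat.{u}) (G := 𝒢.Gv v)) ⋙
        Action.forget FintypeCat.{u} (𝒢.Gv v)) (fiberFunctor_forget_bCat (𝒢.Gv v))
      rw [MonoidHom.coe_range]
      exact (isOpen_range_pi1Map_res_iff (F.hV v) _ (fiberFunctor_forget_bCat (𝒢.Gv v))).mp h
    · have h := @hE e (ObjectProperty.ι (Action.IsContinuous (V := FintypeCat.{u}) (G := 𝒢.Ge e)) ⋙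
        Action.forget FintypeCat.{u} (𝒢.Ge e)) (fiberFunctor_forget_bCat (𝒢.Ge e))
      rw [MonoidHom.coe_range]
      exact (isOpen_range_pi1Map_res_iff (F.hE e) _ (fiberFunctor_forget_bCat (𝒢.Ge e))).mp h
  · rintro ⟨hV, hE⟩
    refine ⟨fun v Fb hFb => ?_, fun e Fb hFb => ?_⟩
    · have h := hV v
      rw [MonoidHom.coe_range] at h
      exact (isOpen_range_pi1Map_res_iff (F.hV v) Fb hFb).mpr h
    · have h := hE e
      rw [MonoidHom.coe_range] at h
      exact (isOpen_range_pi1Map_res_iff (F.hE e) Fb hFb).mpr h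

end ProfiniteSemiGraph

end Literature.AnabelianGeometry.SemiGraphs

end
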